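import Summits.NavierStokesRegularity.NavierStokesRegularity.Theorems.StrainDoorsAlmostMax
import Literature.Analysis.FluidPDE.ClassicalSolutionGlue
import Literature.Analysis.FluidPDE.TaoEnstrophyLocalisation
import HarnessLib

/-!
# StrainDoorsThresholdAncient — S38 «StrainClockDoors» (nsreg-p1 g32, ROUND-36) engine plate
# «StrainThresholdAncient»: the almost-maximiser strain threshold device on a CLOSED BACKWARD SLAB

The NS instance of `StrainDoorsAlmostMax.rayleigh_le_supersolution_of_almostArgmax_growth` (p657155) in the
frame of the ancient argmax law (`ArgmaxDoorsAncient`): a classical unforced solution on a closed slab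
`[s₁,s₂]` with BOUNDED GRADIENT (no decay, no Sobolev class), barrier `B > 0`, `B' ≥ φB`, growth charged at
penalised `(1−δ)`-almost strain maximisers with allowance `η(ε) → 0`, one-sided derivatives within `[s₁,s₂]`
⇒ `⟪∇u(s₁)e,e⟫ ≤ B(s₁)` propagates. Time shift `[s₁,s₂] ↦ [0,s₂−s₁]` (here the preimage is EXACTLY the
shifted slab, so `timeDerivWithin_comp_add_right` applies verbatim) + `HasDerivWithinAt.clm_apply`.

* `strainThresholdAncient`.

HONEST FRAME / WHAT THIS IS NOT: an engine plate for CONDITIONAL Liouville statements / regularity criteria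
(S-door lane, LEAD ns-s30-p1 g3; `--supports stmt-NavierStokesRegularity-0056 --as helper`); item 0056
`NoTypeII`, the walls (10661 / 26991) and NS regularity are NOT proved; no Literature fact is taken as a
hypothesis; nothing here is a route or a summit statement.
-/

noncomputable section

open Set Function Filter Metric MeasureTheory
open scoped RealInnerProductSpace Topology ContDiff

set_option linter.dupNamespace false

namespace Summit.NavierStokesRegularity.NavierStokesRegularity.Theorems.ArgmaxDoors

open Literature.Analysis Literature.Analysis.FluidPDE

set_option maxHeartbeats 800000 in
-- time shift + derivative bookkeeping
/-- **Plate «StrainThresholdAncient» (explicit; bounded-gradient classical slab, no decay, no Sobolev class).**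
`(u,p)` a classical unforced Navier–Stokes solution on a closed slab `[s₁,s₂]` (`ν > 0`) with `‖∇u‖ ≤ K` there;
barrier `B > 0` with `B' ≥ φB` within `[s₁,s₂]`; `0 < δ < 1`; `η(ε) → 0`. IF for every `0 < ε ≤ 1`, every
`s ∈ (s₁,s₂]` and every unit `ē`, `x̄` such that `(x̄,ē)` maximises the penalised strain form
`(1+ε|y|²)⁻¹⟪∇u(s,y)e',e'⟫`, is a `(1−δ)`-almost maximiser of `⟪∇u(s,y)e',e'⟫`, and `⟪∇u(s,x̄)ē,ē⟫ > B(s)`: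
`⟪∂ₛ(∇u ē)(x̄),ē⟫ ≤ (φ(s) + η(ε))⟪∇u(x̄)ē,ē⟫` (one-sided derivative within `[s₁,s₂]`), THEN
`⟪∇u(s₁,·)e,e⟫ ≤ B(s₁)` propagates along the slab. (`rayleigh_le_supersolution_of_almostArgmax_growth`, p657155,
after the shift `[s₁,s₂] ↦ [0,s₂−s₁]`; the engine of the S38 backward/ancient strain laws.) [folklore] -/
theorem strainThresholdAncient :
    ∀ (ν s₁ s₂ δ : ℝ) (η : ℝ → ℝ), 0 < ν → s₁ < s₂ → 0 < δ → δ < 1 → Tendsto η (𝓝[>] 0) (𝓝 0) →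
    ∀ (u : ℝ → (EuclideanSpace ℝ (Fin 3)) → (EuclideanSpace ℝ (Fin 3)))
      (p : ℝ → (EuclideanSpace ℝ (Fin 3)) → ℝ),
      IsClassicalNSSolutionOn (Icc s₁ s₂) ν 0 u p →
      (∃ K : ℝ, ∀ s ∈ Icc s₁ s₂, ∀ x : EuclideanSpace ℝ (Fin 3), ‖fderiv ℝ (u s) x‖ ≤ K) →
      ∀ (B B' φ : ℝ → ℝ), ContinuousOn B (Icc s₁ s₂) → (∀ s ∈ Icc s₁ s₂, 0 < B s) →
        (∀ s ∈ Icc s₁ s₂, HasDerivWithinAt B (B' s) (Icc s₁ s₂) s) →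
        (∀ s ∈ Icc s₁ s₂, φ s * B s ≤ B' s) →
        (∀ ε : ℝ, 0 < ε → ε ≤ 1 → ∀ s ∈ Ioc s₁ s₂, ∀ (x e : EuclideanSpace ℝ (Fin 3)), ‖e‖ = 1 →
          (∀ (y e' : EuclideanSpace ℝ (Fin 3)), ‖e'‖ = 1 →
            (1 + ε * ‖y‖ ^ 2)⁻¹ * ⟪fderiv ℝ (u s) y e', e'⟫ ≤ (1 + ε * ‖x‖ ^ 2)⁻¹ * ⟪fderiv ℝ (u s) x e, e⟫) →
          (∀ (y e' : EuclideanSpace ℝ (Fin 3)), ‖e'‖ = 1 →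
            (1 - δ) * ⟪fderiv ℝ (u s) y e', e'⟫ ≤ ⟪fderiv ℝ (u s) x e, e⟫) →
          B s < ⟪fderiv ℝ (u s) x e, e⟫ →
          ⟪timeDerivWithin (Icc s₁ s₂) (fun r y => fderiv ℝ (u r) y e) s x, e⟫ ≤
            (φ s + η ε) * ⟪fderiv ℝ (u s) x e, e⟫) →
        (∀ (x e : EuclideanSpace ℝ (Fin 3)), ‖e‖ = 1 → ⟪fderiv ℝ (u s₁) x e, e⟫ ≤ B s₁) →
        ∀ s ∈ Icc s₁ s₂, ∀ (x e : EuclideanSpace ℝ (Fin 3)), ‖e‖ = 1 → ⟪fderiv ℝ (u s) x e, e⟫ ≤ B s := by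
  intro ν s₁ s₂ δ η hν h12 hδ hδ1 hη u p hsol hK B B' φ hBc hBpos hBd hsuper hrate hinit s hs x e he
  set L : ℝ := s₂ - s₁ with hLdef
  have hL : 0 < L := by rw [hLdef]; linarith
  have hUS : UniqueDiffOn ℝ (Icc s₁ s₂) := uniqueDiffOn_Icc h12
  have hUL : UniqueDiffOn ℝ (Icc (0 : ℝ) L) := uniqueDiffOn_Icc hL
  set G : ℝ → (EuclideanSpace ℝ (Fin 3)) → ((EuclideanSpace ℝ (Fin 3)) →L[ℝ] (EuclideanSpace ℝ (Fin 3))) :=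
    fun r y => fderiv ℝ (u r) y with hG
  have hGs : IsSmoothSpaceTimeOn (Icc s₁ s₂) G := hsol.smooth_velocity.fderiv_slice hUS
  have hmem : ∀ r ∈ Icc (0 : ℝ) L, r + s₁ ∈ Icc s₁ s₂ := fun r hr =>
    ⟨by linarith [hr.1], by rw [hLdef] at hr; linarith [hr.2]⟩
  have hpre : (· + s₁) ⁻¹' Icc s₁ s₂ = Icc (0 : ℝ) L := by
    ext r; simp only [mem_preimage, mem_Icc, hLdef]; constructor <;> intro h <;> constructor <;> linarith [h.1, h.2]
  set W : ℝ → (EuclideanSpace ℝ (Fin 3)) → ((EuclideanSpace ℝ (Fin 3)) →L[ℝ] (EuclideanSpace ℝ (Fin 3))) :=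
    fun r y => G (r + s₁) y with hW
  have hWs : IsSmoothSpaceTimeOn (Icc 0 L) W := by
    have h := hGs.comp_add_right s₁
    rw [hpre] at h
    exact h
  have hbdd : ∃ K : ℝ, ∀ r ∈ Icc 0 L, ∀ y : EuclideanSpace ℝ (Fin 3), ‖W r y‖ ≤ K := by
    obtain ⟨K, hK'⟩ := hK
    exact ⟨K, fun r hr y => by simpa [hW, hG] using hK' (r + s₁) (hmem r hr) y⟩
  -- the shifted barrier
  have hBc' : ContinuousOn (fun r => B (r + s₁)) (Icc 0 L) :=
    hBc.comp (continuous_add_const s₁).continuousOn hmem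
  have hBpos' : ∀ r ∈ Icc 0 L, 0 < B (r + s₁) := fun r hr => hBpos _ (hmem r hr)
  have hBd' : ∀ r ∈ Icc 0 L, HasDerivWithinAt (fun r' => B (r' + s₁)) (B' (r + s₁)) (Icc 0 L) r := by
    intro r hr
    have h1 : HasDerivWithinAt (fun r' : ℝ => r' + s₁) 1 (Icc 0 L) r := (hasDerivWithinAt_id r _).add_const s₁
    have h := (hBd (r + s₁) (hmem r hr)).comp r h1 (fun r' hr' => hmem r' hr')
    rw [mul_one] at h
    exact h
  have hsuper' : ∀ r ∈ Icc 0 L, φ (r + s₁) * B (r + s₁) ≤ B' (r + s₁) := fun r hr => hsuper _ (hmem r hr)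
  -- the time derivative of the shifted operator field, applied to `e₀`
  have hkey : ∀ r ∈ Icc 0 L, ∀ (x₀ e₀ : EuclideanSpace ℝ (Fin 3)),
      timeDerivWithin (Icc 0 L) W r x₀ e₀ =
        timeDerivWithin (Icc s₁ s₂) (fun r' y => fderiv ℝ (u r') y e₀) (r + s₁) x₀ := by
    intro r hr x₀ e₀
    have hr' : r + s₁ ∈ Icc s₁ s₂ := hmem r hr
    set D := timeDerivWithin (Icc s₁ s₂) G (r + s₁) x₀ with hD
    have hF : HasDerivWithinAt (fun r' => G r' x₀) D (Icc s₁ s₂) (r + s₁) := by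
      rw [hD, timeDerivWithin_apply]
      exact (hGs.differentiableWithinAt_time hr' x₀).hasDerivWithinAt
    have h1 : timeDerivWithin (Icc s₁ s₂) (fun r' y => fderiv ℝ (u r') y e₀) (r + s₁) x₀ = D e₀ := by
      rw [timeDerivWithin_apply]
      have h := hF.clm_apply (hasDerivWithinAt_const (r + s₁) (Icc s₁ s₂) e₀)
      have h' : HasDerivWithinAt (fun r' => G r' x₀ e₀) (D e₀) (Icc s₁ s₂) (r + s₁) := by simpa using h
      exact h'.derivWithin (hUS _ hr')
    have h2 : timeDerivWithin (Icc 0 L) W r x₀ = D := by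
      have e1 := timeDerivWithin_comp_add_right (Icc s₁ s₂) G s₁ r x₀
      rw [hpre] at e1
      exact e1
    rw [h2, h1]
  have hgrow : ∀ ε : ℝ, 0 < ε → ε ≤ 1 → ∀ r ∈ Icc 0 L, 0 < r → ∀ (x₀ e₀ : EuclideanSpace ℝ (Fin 3)), ‖e₀‖ = 1 →
      (∀ (y e' : EuclideanSpace ℝ (Fin 3)), ‖e'‖ = 1 →
        (1 + ε * ‖y‖ ^ 2)⁻¹ * ⟪W r y e', e'⟫ ≤ (1 + ε * ‖x₀‖ ^ 2)⁻¹ * ⟪W r x₀ e₀, e₀⟫) →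
      (∀ (y e' : EuclideanSpace ℝ (Fin 3)), ‖e'‖ = 1 → (1 - δ) * ⟪W r y e', e'⟫ ≤ ⟪W r x₀ e₀, e₀⟫) →
      B (r + s₁) < ⟪W r x₀ e₀, e₀⟫ →
      ⟪timeDerivWithin (Icc 0 L) W r x₀ e₀, e₀⟫ ≤ (φ (r + s₁) + η ε) * ⟪W r x₀ e₀, e₀⟫ := by
    intro ε hε hε1 r hr hrpos x₀ e₀ he₀ hpen halmost hbig
    rw [hkey r hr x₀ e₀]
    exact hrate ε hε hε1 (r + s₁) ⟨by linarith, (hmem r hr).2⟩ x₀ e₀ he₀ hpen halmost hbig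
  have hM : ∀ (y e' : EuclideanSpace ℝ (Fin 3)), ‖e'‖ = 1 → ⟪W 0 y e', e'⟫ ≤ B (0 + s₁) := by
    intro y e' he'
    simp only [hW, hG, zero_add]
    exact hinit y e' he'
  have hmain := rayleigh_le_supersolution_of_almostArgmax_growth (φ := fun r => φ (r + s₁)) hWs hbdd hBc'
    hBpos' hBd' hsuper' hδ hδ1 hη hgrow hM (s - s₁) ⟨by linarith [hs.1], by rw [hLdef]; linarith [hs.2]⟩ x e he
  simp only [hW, hG, sub_add_cancel] at hmain
  exact hmain

end Summit.NavierStokesRegularity.NavierStokesRegularity.Theorems.ArgmaxDoors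

end
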